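import Literature.AlgebraicGeometry.HodgeTheory.AbelianVarietyEndAlgebraReducedIffEndReduced
import Literature.AlgebraicGeometry.HodgeTheory.AbelianVarietyIsotypicCentralIdempotents
import Literature.AlgebraicGeometry.Motives.AbelianVarietySimpleOfEndAlgebraDomain
import HarnessLib

/-!
# When is `End⁰(X)` commutative?  Iff `X` is isogenous to a product of pairwise non-isogenous simple abelian varieties whose
# endomorphism algebras are fields; `End⁰(X)` is a field iff `X` is simple with commutative `End⁰(X)`
# (Mumford §19 Cor. 2; Shimura 1998 §5.1 Prop. 1, 3–4)

Layer `Literature/AlgebraicGeometry/HodgeTheory`; theorems only (no `def`, no instance, no named fact; net debt 0).  In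
`End⁰ X = ⊕_i M_{n_i}(D_i)` (Mumford §19 Cor. 2) commutativity means: every `n_i = 1` AND every division algebra `D_i = End⁰ X_i` is
commutative, i.e. a field.  `HodgeTheory/AbelianVarietyCommutativeEndSubvarieties` proved the first half («commutative ⟹
multiplicity-free ⟹ `X ∼ ⨁` distinct simples»); this file completes the criterion and adds the converse.  §1 holds over ANY
field: commutativity passes between the order `End X` and the algebra `End⁰ X` (so commutativity of `End X` is an isogeny
invariant), and for a SIMPLE `X` of positive dimension `End⁰ X` is a field iff it is commutative (the tree's any-field
`ComplexMultiplication.endAlgebra_exists_inv_of_isSimple`; this generalises the `K = ℂ` statement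
`isField_endAlgebra_of_isSimple_of_forall_mul_comm` of `HodgeTheory/TimesTotallyRealFieldStablyNondegenerateProductSpan`, not
restated).  §2 is over a PERFECT field (isotypic components; `Hom(B, B') = 0` for non-isogenous simple `B`, `B'`; a division
algebra `End⁰ X` forces `X` simple, `Motives.isSimple_of_isField_endAlgebra`).

THE PRINT.  Mumford, *Abelian Varieties* (1970) §19 Cor. 2 of Thm. 1 (p. 174: `End⁰ X = ⊕ M_{n_i}(D_i)`, `D_i = End⁰ X_i` a division
algebra); Shimura, *Abelian Varieties with Complex Multiplication and Modular Functions* (1998) §5.1 Prop. 1 and Prop. 3–4 (a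
commutative semisimple subalgebra of `End⁰ X`; `End⁰(A^n) = M_n(End⁰ A)`; `End⁰` of a simple abelian variety is a division
algebra); Milne, *Abelian Varieties* (1986) §12 p. 122 (PDF p. 189).

Results (namespace `Literature.AlgebraicGeometry.HodgeTheory.AbelianVariety`):
* §1 (any field) `comm_endAlgebra_of_comm_end`, **`endAlgebra_comm_iff_end_comm`**, **`end_comm_iff_of_isIsogenous`** (commutativity
  of `End X` is an isogeny invariant), `nontrivial_endAlgebra_of_pos_dim`, `isField_endAlgebra_of_isSimple_of_comm_anyField`,
  **`isField_endAlgebra_iff_comm_of_isSimple`**, `isField_endAlgebra_iff_end_comm_of_isSimple`, `endAlgebra_comm_biproduct_of_isField`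
  (`⨁ B_q` with `End⁰ B_q` fields and `Hom(B_q, B_{q'}) = 0`);
* §2 (perfect field) **`isField_endAlgebra_iff_isSimple_and_comm`**,
  **`endAlgebra_comm_iff_forall_multiplicity_eq_zero_and_forall_comm`** (isotypic components: commutative ⟺
  all `n_q = 0` and all `End⁰ B_q` commutative), **`endAlgebra_comm_iff_exists_isIsogenous_biproduct_isField`** (every `X`:
  `End⁰ X` commutative ⟺ `X ∼ ⨁_{q<r} B_q`, `End⁰ B_q` fields, `B_q` of positive dimension pairwise non-isogenous),
  `end_comm_iff_exists_isIsogenous_biproduct_isField`, `endAlgebra_comm_of_isIsogenous_biproduct_isField`.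

## References
* [MumfordAV1970] D. Mumford, *Abelian Varieties* (1970), §19 Cor. 2 of Thm. 1 (p. 174) and Thm. 3 (p. 176).
* [Shimura1998] G. Shimura, *Abelian Varieties with Complex Multiplication and Modular Functions* (1998), §5.1 Prop. 1, 3–4.
* [Milne1986AbelianVarieties] J. S. Milne, *Abelian Varieties*, in Cornell–Silverman (1986), §12 p. 122 (PDF p. 189).
-/

noncomputable section

universe u

open CategoryTheory CategoryTheory.Limits

namespace Literature.AlgebraicGeometry.HodgeTheory

namespace AbelianVariety

open _root_.AlgebraicGeometry
open Literature.AlgebraicGeometry.Motives Literature.AlgebraicGeometry.Motives.AbelianVariety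

variable {K : Type u} [Field K]

/-! ## §1 Commutativity of `End X` versus `End⁰ X`; when `End⁰ X` is a field (any field) -/

section AnyField

variable {X X' : Motives.AbelianVariety K}

/-- Commutativity of `End X` implies commutativity of `End⁰ X = ℚ ⊗ End X` (every element is `M⁻¹ · (1 ⊗ F)`).
[cite: MumfordAV1970, §19 Thm. 3 (p. 176) and Cor. 2 of Thm. 1 (p. 174)] -/
theorem comm_endAlgebra_of_comm_end (hcomm : ∀ φ ψ : X ⟶ X, φ ≫ ψ = ψ ≫ φ) (x y : X.endAlgebra) : x * y = y * x := by
  obtain ⟨M, F, -, rfl⟩ := endAlgebra.exists_eq_algebraMap_mul_of x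
  obtain ⟨N, G, -, rfl⟩ := endAlgebra.exists_eq_algebraMap_mul_of y
  have hFG : endAlgebra.of X F * endAlgebra.of X G = endAlgebra.of X G * endAlgebra.of X F := by
    rw [← map_mul, ← map_mul, End.mul_def, End.mul_def]
    exact congrArg (endAlgebra.of X) (hcomm G F)
  rw [← Algebra.smul_def, ← Algebra.smul_def]
  simp only [smul_mul_assoc, mul_smul_comm, smul_smul]
  rw [hFG, mul_comm ((M : ℚ)⁻¹)]

/-- **`End⁰ X` IS COMMUTATIVE IFF `End X` IS** (any field). [cite: MumfordAV1970, §19 Thm. 3 (p. 176) and Cor. 2 of Thm. 1 (p. 174)] -/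
theorem endAlgebra_comm_iff_end_comm : (∀ x y : X.endAlgebra, x * y = y * x) ↔ ∀ φ ψ : X ⟶ X, φ ≫ ψ = ψ ≫ φ :=
  ⟨comm_end_of_comm_endAlgebra, comm_endAlgebra_of_comm_end⟩

/-- **COMMUTATIVITY OF `End X` IS AN ISOGENY INVARIANT** (any field): `End⁰` is, and commutativity passes between `End` and
`End⁰`. [cite: MumfordAV1970, §19 Cor. 2 of Thm. 1 (p. 174) and Remark p. 169] [cite: Milne1986AbelianVarieties, §12 p. 122 (PDF p. 189)] -/
theorem end_comm_iff_of_isIsogenous (h : IsIsogenous X X') :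
    (∀ φ ψ : X ⟶ X, φ ≫ ψ = ψ ≫ φ) ↔ ∀ φ ψ : X' ⟶ X', φ ≫ ψ = ψ ≫ φ := by
  rw [← endAlgebra_comm_iff_end_comm, ← endAlgebra_comm_iff_end_comm, h.endAlgebra_comm_iff]

/-- `End⁰ X` is non-trivial for `0 < dim X` (any field: `𝟙_X ≠ 0` and `End X ↪ End⁰ X`). [cite: MumfordAV1970, §19 Thm. 3 (p. 176)] -/
theorem nontrivial_endAlgebra_of_pos_dim (hX0 : 0 < X.dim) : Nontrivial X.endAlgebra := by
  refine ⟨⟨0, 1, fun h01 ↦ id_ne_zero_of_dim_pos hX0 ?_⟩⟩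
  have h : endAlgebra.of X 1 = endAlgebra.of X 0 := by rw [map_zero, map_one, h01]
  exact endAlgebra.of_injective_of_isIsogeny_zsmul_id (isIsogeny_zsmul_id_holds X) h

/-- **A simple `X` of positive dimension with commutative `End⁰ X` has `End⁰ X` a field** (ANY base field: `End⁰` of a simple
abelian variety is a division algebra, `ComplexMultiplication.endAlgebra_exists_inv_of_isSimple`; the tree's
`AbelianVariety.isField_endAlgebra_of_isSimple_of_comm` in `HodgeTheory/SimpleAbelianSurfacePowersHodgeClasses` is the case `K = ℂ`).
[cite: MumfordAV1970, §19 Cor. 2 of Thm. 1 (p. 174)]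
[cite: Shimura1998, §5.1 Prop. 3–4] -/
theorem isField_endAlgebra_of_isSimple_of_comm_anyField (hX : X.IsSimple) (hX0 : 0 < X.dim)
    (hcomm : ∀ x y : X.endAlgebra, x * y = y * x) : IsField X.endAlgebra := by
  haveI := nontrivial_endAlgebra_of_pos_dim hX0
  refine ⟨exists_pair_ne _, hcomm, fun {x} hx ↦ ?_⟩
  obtain ⟨y, hxy, -⟩ := Literature.AlgebraicGeometry.ComplexMultiplication.endAlgebra_exists_inv_of_isSimple hX x hx
  exact ⟨y, hxy⟩

/-- For a simple `X` of positive dimension: `End⁰ X` is a field iff it is commutative (any field).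
[cite: MumfordAV1970, §19 Cor. 2 of Thm. 1 (p. 174)] [cite: Shimura1998, §5.1 Prop. 3–4] -/
theorem isField_endAlgebra_iff_comm_of_isSimple (hX : X.IsSimple) (hX0 : 0 < X.dim) :
    IsField X.endAlgebra ↔ ∀ x y : X.endAlgebra, x * y = y * x :=
  ⟨fun hF ↦ hF.mul_comm, isField_endAlgebra_of_isSimple_of_comm_anyField hX hX0⟩

/-- … equivalently iff the order `End X` is commutative (any field). [cite: MumfordAV1970, §19 Cor. 2 of Thm. 1 (p. 174) and Thm. 3 (p. 176)] -/
theorem isField_endAlgebra_iff_end_comm_of_isSimple (hX : X.IsSimple) (hX0 : 0 < X.dim) :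
    IsField X.endAlgebra ↔ ∀ φ ψ : X ⟶ X, φ ≫ ψ = ψ ≫ φ := by
  rw [isField_endAlgebra_iff_comm_of_isSimple hX hX0, endAlgebra_comm_iff_end_comm]

/-- `End⁰(⨁ B_q)` is commutative when the `End⁰ B_q` are fields and `Hom(B_q, B_{q'}) = 0` for `q ≠ q'` (any field).
[cite: MumfordAV1970, §19 Cor. 2 of Thm. 1 (p. 174)] -/
theorem endAlgebra_comm_biproduct_of_isField {Q : Type} [Fintype Q] [DecidableEq Q] {B : Q → Motives.AbelianVariety K}
    (hF : ∀ q, IsField (B q).endAlgebra) (horth : ∀ q q', q ≠ q' → ∀ f : B q ⟶ B q', f = 0)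
    (x y : (⨁ B).endAlgebra) : x * y = y * x :=
  (endAlgebra_biproduct_comm_iff horth).2 (fun q ↦ (hF q).mul_comm) x y

end AnyField

/-! ## §2 The criterion over a perfect field -/

section Perfect

variable [PerfectField K] {Q : Type} [Fintype Q] {B : Q → Motives.AbelianVariety K} {n : Q → ℕ} {X : Motives.AbelianVariety K}
  {Y : Q → Motives.AbelianVariety K}

/-- **`End⁰ X` IS A FIELD IFF `X` IS SIMPLE WITH COMMUTATIVE `End⁰ X`** (perfect field, `0 < dim X`): `End⁰` of a simple
abelian variety is a division algebra, and conversely a division algebra `End⁰ X` forces `X` simple (Poincaré reducibility,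
the tree's `Motives.isSimple_of_isField_endAlgebra`). [cite: MumfordAV1970, §19 Cor. 2 of Thm. 1 (p. 174)] [cite: Shimura1998, §5.1 Prop. 3–4] -/
theorem isField_endAlgebra_iff_isSimple_and_comm (hX0 : 0 < X.dim) :
    IsField X.endAlgebra ↔ X.IsSimple ∧ ∀ x y : X.endAlgebra, x * y = y * x :=
  ⟨fun hF ↦ ⟨isSimple_of_isField_endAlgebra hF, hF.mul_comm⟩, fun h ↦ isField_endAlgebra_of_isSimple_of_comm_anyField h.1 hX0 h.2⟩

/-- **`End⁰ X` IS COMMUTATIVE IFF `X` IS MULTIPLICITY-FREE WITH COMMUTATIVE `End⁰ B_q`** (perfect field; isotypic components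
`Y_q ∼ B_q^{n_q+1}`, `B_q` simple of positive dimension pairwise non-isogenous, addition map an isogeny):
`End⁰ X = ⊕ M_{n_q+1}(End⁰ B_q)` is commutative iff all `n_q = 0` and all `End⁰ B_q` are commutative.
[cite: MumfordAV1970, §19 Cor. 2 of Thm. 1 (p. 174)] [cite: Shimura1998, §5.1 Prop. 3–4] -/
theorem endAlgebra_comm_iff_forall_multiplicity_eq_zero_and_forall_comm (hB : ∀ q, (B q).IsSimple) (hB0 : ∀ q, 0 < (B q).dim)
    (hni : ∀ q q', q ≠ q' → ¬ IsIsogenous (B q) (B q')) (hY : ∀ q, IsIsogenous (Y q) (⨁ fun _ : Fin (n q + 1) ↦ B q))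
    (i : ∀ q, Y q ⟶ X) (hi : ∀ q, IsClosedImmersion (Hom.toSchemeHom (i q))) (hdesc : IsIsogeny (biproduct.desc i)) :
    (∀ x y : X.endAlgebra, x * y = y * x) ↔ (∀ q, n q = 0) ∧ ∀ q, ∀ x y : (B q).endAlgebra, x * y = y * x := by
  classical
  have horth : ∀ q q', q ≠ q' → ∀ f : Y q ⟶ Y q', f = 0 := fun q q' hqq' f ↦
    hom_eq_zero_of_isIsogenous_biproduct_const_of_ne hB hB0 hni hqq' (hY q) (hY q') f
  have hYB : ∀ q, n q = 0 → IsIsogenous (Y q) (B q) := fun q h0 ↦ by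
    have hd : (Y q).dim = (B q).dim := by
      rw [dim_eq_mul_of_isIsogenous_biproduct_const (hY q), h0, zero_add, one_mul]
    exact isIsogenous_of_isIsogenous_biproduct_const_of_dim_le (hY q) (by rw [hd]; exact hB0 q) hd.le
  rw [endAlgebra_comm_iff_forall_components (i := i) hdesc horth]
  constructor
  · intro h
    have h0 : ∀ q, n q = 0 := forall_multiplicity_eq_zero_of_forall_comm hY i hi hdesc hB0
      (comm_end_of_comm_endAlgebra ((endAlgebra_comm_iff_forall_components (i := i) hdesc horth).2 h))
    exact ⟨h0, fun q ↦ ((hYB q (h0 q)).endAlgebra_comm_iff).1 (h q)⟩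
  · rintro ⟨h0, hc⟩ q
    exact ((hYB q (h0 q)).endAlgebra_comm_iff).2 (hc q)

/-- **`End⁰ X` IS COMMUTATIVE IFF `X ∼ ⨁_{q<r} B_q` WITH `End⁰ B_q` FIELDS, `B_q` OF POSITIVE DIMENSION AND PAIRWISE NON-ISOGENOUS**
(every abelian variety over a perfect field; then `End⁰ X ≅ ∏_q End⁰ B_q` is a product of fields).  Such `B_q` are simple
(`Motives.isSimple_of_isField_endAlgebra`). [cite: MumfordAV1970, §19 Cor. 2 of Thm. 1 (p. 174)] [cite: Shimura1998, §5.1 Prop. 1, 3–4] -/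
theorem endAlgebra_comm_iff_exists_isIsogenous_biproduct_isField (X : Motives.AbelianVariety K) :
    (∀ x y : X.endAlgebra, x * y = y * x) ↔ ∃ (r : ℕ) (B : Fin r → Motives.AbelianVariety K),
      (∀ q, IsField (B q).endAlgebra) ∧ (∀ q, 0 < (B q).dim) ∧ (∀ q q', q ≠ q' → ¬ IsIsogenous (B q) (B q')) ∧
        IsIsogenous X (⨁ B) := by
  classical
  constructor
  · intro hcomm
    obtain ⟨r, B, n, Y, i, hB, hB0, hni, hi, hY, -, hdesc, -⟩ := exists_isotypicComponents_orthogonal X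
    obtain ⟨h0, hc⟩ := (endAlgebra_comm_iff_forall_multiplicity_eq_zero_and_forall_comm hB hB0 hni hY i hi hdesc).1 hcomm
    have hYB : ∀ q, IsIsogenous (Y q) (B q) := fun q ↦ by
      have hd : (Y q).dim = (B q).dim := by
        rw [dim_eq_mul_of_isIsogenous_biproduct_const (hY q), h0 q, zero_add, one_mul]
      exact isIsogenous_of_isIsogenous_biproduct_const_of_dim_le (hY q) (by rw [hd]; exact hB0 q) hd.le
    exact ⟨r, B, fun q ↦ (isField_endAlgebra_iff_comm_of_isSimple (hB q) (hB0 q)).2 (hc q), hB0, hni,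
      (IsIsogenous.symm' ⟨biproduct.desc i, hdesc⟩).trans (IsIsogenous.biproduct hYB)⟩
  · rintro ⟨r, B, hF, hB0, hni, hX⟩
    have hB : ∀ q, (B q).IsSimple := fun q ↦ isSimple_of_isField_endAlgebra (hF q)
    have horth : ∀ q q', q ≠ q' → ∀ f : B q ⟶ B q', f = 0 := fun q q' hqq' f ↦
      hom_eq_zero_of_isSimple_of_not_isIsogenous_of_perfectField (hB q) (hB q') (hni q q' hqq') f
    exact hX.endAlgebra_comm_iff.2 (endAlgebra_comm_biproduct_of_isField hF horth)

/-- The same criterion for the ORDER `End X`: `End X` is commutative iff `X ∼ ⨁_{q<r} B_q` with `End⁰ B_q` fields, `B_q` of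
positive dimension pairwise non-isogenous (perfect field). [cite: MumfordAV1970, §19 Cor. 2 of Thm. 1 (p. 174) and Thm. 3 (p. 176)] -/
theorem end_comm_iff_exists_isIsogenous_biproduct_isField (X : Motives.AbelianVariety K) :
    (∀ φ ψ : X ⟶ X, φ ≫ ψ = ψ ≫ φ) ↔ ∃ (r : ℕ) (B : Fin r → Motives.AbelianVariety K),
      (∀ q, IsField (B q).endAlgebra) ∧ (∀ q, 0 < (B q).dim) ∧ (∀ q q', q ≠ q' → ¬ IsIsogenous (B q) (B q')) ∧
        IsIsogenous X (⨁ B) := by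
  rw [← endAlgebra_comm_iff_end_comm, endAlgebra_comm_iff_exists_isIsogenous_biproduct_isField]

/-- `X ∼ ⨁_q B_q` with `End⁰ B_q` fields and the `B_q` of positive dimension pairwise non-isogenous ⟹ `End⁰ X` commutative
(perfect field; any finite index type). [cite: MumfordAV1970, §19 Cor. 2 of Thm. 1 (p. 174)] -/
theorem endAlgebra_comm_of_isIsogenous_biproduct_isField [DecidableEq Q] (hF : ∀ q, IsField (B q).endAlgebra)
    (hni : ∀ q q', q ≠ q' → ¬ IsIsogenous (B q) (B q')) (hX : IsIsogenous X (⨁ B)) (x y : X.endAlgebra) : x * y = y * x := by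
  have hB : ∀ q, (B q).IsSimple := fun q ↦ isSimple_of_isField_endAlgebra (hF q)
  have horth : ∀ q q', q ≠ q' → ∀ f : B q ⟶ B q', f = 0 := fun q q' hqq' f ↦
    hom_eq_zero_of_isSimple_of_not_isIsogenous_of_perfectField (hB q) (hB q') (hni q q' hqq') f
  exact hX.endAlgebra_comm_iff.2 (endAlgebra_comm_biproduct_of_isField hF horth) x y

end Perfect

end AbelianVariety

end Literature.AlgebraicGeometry.HodgeTheory

end
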